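import Literature.Probability.Distributions.GaussianMoments
import HarnessLib

/-!
# EnskogAdjointDuality / AdjointEnskogTestFamilyR — refutation line, stub `halfGaussian` (prep):
# one-dimensional half-Gaussian moments

Support lemmas for the registered stub `stub_halfGaussian` of the line `refutation` of the crux K2R
`Summit.AtomisticToContinuum.HydrodynamicLimit.Theses.EnskogAdjointDuality.AdjointEnskogTestFamilyR`
(stmt-AtomisticToContinuum-11592).  With `γ₁ = gaussianReal 0 1` (density
`φ₁(b) = e^{-b²/2}/√(2π)`, `k2r_ref_phi_eq`) and

* `h(a)  = ∫ (a − b)₊ dγ₁(b)`       (half-Gaussian mean, `= aΦ(a) + φ₁(a)`),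
* `P₂(a) = ∫ (a − b)₊² dγ₁(b)`, `P₃(a) = ∫ (a − b)₊ (a² − b²) dγ₁(b)`,

we prove, by pointwise integrand bounds and the Gaussian moments `E b = E b³ = 0`, `E b² = 1`,
`E b⁴ = 3` (`Literature.Probability.Distributions.GaussianMoments`) — no closed forms are needed:

* `k2r_ref_h_ge`, `k2r_ref_h_sub_h_neg`, `k2r_ref_h_le_exp` — `h(a) ≥ a₊`, `h(a) − h(−a) = a`
  (reflection symmetry of `γ₁`), and `h(a) ≤ e^{-a²/2}` for `a ≤ 0` (pointwise
  `e^{-b²/2} ≤ e^{-a²/2} e^{-(a-b)²/2}` for `b ≤ a ≤ 0`, translation invariance of Lebesgue measure,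
  `E c₊ ≤ E (1 + c²)/2 = 1`);
* `k2r_ref_P2_bounds` — `0 ≤ P₂(a) ≤ E (a − b)² = 1 + a²`;
* `k2r_ref_P3_bound` — `|P₃(a) − a₊³| ≤ 3 (1 + |a|)` (`P₃(a) = a³ − a + ∫ (b − a)₊ (a² − b²) dγ₁` for
  `a ≥ 0`, remainder and the `a ≤ 0` integral bounded by `E (b² + b⁴)/2 = 2`);

References: standard facts on the normal distribution (folklore); C. Cercignani, R. Illner,
M. Pulvirenti, *The Mathematical Theory of Dilute Gases* (1994), §7.2 for the context (loss term of the
linearised hard-sphere operator) [CIP1994].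
-/

noncomputable section

open MeasureTheory ProbabilityTheory Set Filter Topology
open scoped Real ENNReal NNReal Nat

namespace Summit.AtomisticToContinuum.HydrodynamicLimit.Theorems.EnskogAdjointDuality

open Literature.Probability.Distributions

/-! ## The standard normal density and its moments -/

/-- The standard normal density is Mathlib's `gaussianPDFReal 0 1`. [folklore] -/
theorem k2r_ref_phi_eq (b : ℝ) :
    Real.exp (-b ^ 2 / 2) / Real.sqrt (2 * Real.pi) = gaussianPDFReal 0 1 b := by
  rw [gaussianPDFReal_def]
  simp only [NNReal.coe_one, mul_one, sub_zero]
  rw [div_eq_inv_mul]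

/-- Lebesgue integrals against the standard normal density are integrals against `gaussianReal 0 1`
(no integrability needed). [folklore] -/
theorem k2r_ref_integral_mul_phi (F : ℝ → ℝ) :
    ∫ b, F b * (Real.exp (-b ^ 2 / 2) / Real.sqrt (2 * Real.pi)) = ∫ b, F b ∂gaussianReal 0 1 := by
  rw [integral_gaussianReal_eq_integral_smul one_ne_zero]
  refine integral_congr_ae (ae_of_all _ fun b => ?_)
  show F b * _ = _ • F b
  rw [k2r_ref_phi_eq, smul_eq_mul, mul_comm]

/-- `∫ b dγ₁ = 0`. [folklore] -/
theorem k2r_ref_moment_one : ∫ b, b ∂gaussianReal 0 1 = 0 := integral_id_gaussianReal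

/-- `∫ b² dγ₁ = 1`. [folklore] -/
theorem k2r_ref_moment_two : ∫ b, b ^ 2 ∂gaussianReal 0 1 = 1 := by
  have h := integral_pow_even_gaussianReal_one 1
  simpa using h

/-- `∫ b³ dγ₁ = 0`. [folklore] -/
theorem k2r_ref_moment_three : ∫ b, b ^ 3 ∂gaussianReal 0 1 = 0 := by
  have h := integral_pow_odd_gaussianReal 1 1
  simpa using h

/-- `∫ b⁴ dγ₁ = 3`. [folklore] -/
theorem k2r_ref_moment_four : ∫ b, b ^ 4 ∂gaussianReal 0 1 = 3 := by
  have h := integral_pow_even_gaussianReal_one 2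
  have h3 : ((2 * 2 - 1 : ℕ)‼ : ℝ) = 3 := by norm_num [Nat.doubleFactorial]
  rw [h3] at h
  simpa using h

/-- `(1 + |b|)ⁿ` is `γ₁`-integrable. [folklore] -/
theorem k2r_ref_integrable_one_add_abs_pow (n : ℕ) :
    Integrable (fun b : ℝ => (1 + |b|) ^ n) (gaussianReal 0 1) := by
  have h0 : MemLp (fun b : ℝ => |b|) (n : ℝ≥0∞) (gaussianReal 0 1) :=
    (memLp_id_gaussianReal' (μ := 0) (v := 1) n (ENNReal.natCast_ne_top n)).norm
  have h1 : MemLp (fun b : ℝ => 1 + |b|) (n : ℝ≥0∞) (gaussianReal 0 1) := (memLp_const (1 : ℝ)).add h0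
  refine h1.integrable_norm_pow'.congr (ae_of_all _ fun b => ?_)
  change ‖1 + |b|‖ ^ n = (1 + |b|) ^ n
  rw [Real.norm_of_nonneg (by positivity)]

/-- Polynomially bounded (a.e.-strongly measurable) functions are `γ₁`-integrable. [folklore] -/
theorem k2r_ref_integrable_of_le_poly {f : ℝ → ℝ} (hf : AEStronglyMeasurable f (gaussianReal 0 1))
    {C : ℝ} {n : ℕ} (h : ∀ b, |f b| ≤ C * (1 + |b|) ^ n) : Integrable f (gaussianReal 0 1) :=
  ((k2r_ref_integrable_one_add_abs_pow n).const_mul C).mono' hf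
    (ae_of_all _ fun b => (Real.norm_eq_abs _).le.trans (h b))

/-! ## Polynomial moments and elementary pointwise facts -/

/-- `∫ (c₀ + c₁ b + c₂ b² + c₃ b³ + c₄ b⁴) dγ₁ = c₀ + c₂ + 3 c₄`. [folklore] -/
theorem k2r_ref_integral_poly (c₀ c₁ c₂ c₃ c₄ : ℝ) :
    ∫ b, (c₀ + c₁ * b + c₂ * b ^ 2 + c₃ * b ^ 3 + c₄ * b ^ 4) ∂gaussianReal 0 1 = c₀ + c₂ + 3 * c₄ := by
  have hi : ∀ (k : ℕ) (c : ℝ), Integrable (fun b : ℝ => c * b ^ k) (gaussianReal 0 1) := fun k c =>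
    (integrable_pow_gaussianReal 0 1 k).const_mul c
  have h1 : Integrable (fun b : ℝ => c₁ * b) (gaussianReal 0 1) := by
    simpa using hi 1 c₁
  have h01 : Integrable (fun b : ℝ => c₀ + c₁ * b) (gaussianReal 0 1) := (integrable_const c₀).add h1
  have h012 : Integrable (fun b : ℝ => c₀ + c₁ * b + c₂ * b ^ 2) (gaussianReal 0 1) := h01.add (hi 2 c₂)
  have h0123 : Integrable (fun b : ℝ => c₀ + c₁ * b + c₂ * b ^ 2 + c₃ * b ^ 3) (gaussianReal 0 1) :=
    h012.add (hi 3 c₃)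
  rw [integral_add h0123 (hi 4 c₄), integral_add h012 (hi 3 c₃), integral_add h01 (hi 2 c₂),
    integral_add (integrable_const c₀) h1, integral_const, integral_const_mul, integral_const_mul,
    integral_const_mul, integral_const_mul, k2r_ref_moment_one, k2r_ref_moment_two,
    k2r_ref_moment_three, k2r_ref_moment_four]
  simp only [smul_eq_mul, probReal_univ, one_mul]
  ring

/-- `|x₊| ≤ |x|`. [folklore] -/
theorem k2r_ref_abs_posPart_le (x : ℝ) : |max x 0| ≤ |x| := by
  rw [abs_of_nonneg (le_max_right x 0)]
  exact max_le (le_abs_self x) (abs_nonneg x)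

/-- `x₊ = (−x)₊ + x`. [folklore] -/
theorem k2r_ref_posPart_eq (x : ℝ) : max x 0 = max (-x) 0 + x := by
  have h := max_zero_sub_max_neg_zero_eq_self x
  linarith

/-- `x₊ ≤ (1 + x²)/2`. [folklore] -/
theorem k2r_ref_posPart_le_quad (x : ℝ) : max x 0 ≤ 1 / 2 + 0 * x + 1 / 2 * x ^ 2 + 0 * x ^ 3 + 0 * x ^ 4 := by
  refine max_le ?_ ?_ <;> nlinarith [sq_nonneg (x - 1), sq_nonneg x]

/-- The cubic remainder: for `a ≥ 0`, `|(b − a)₊ (a² − b²)| ≤ (b² + b⁴)/2`. [folklore] -/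
theorem k2r_ref_cubic_pt {a : ℝ} (ha : 0 ≤ a) (b : ℝ) :
    |max (b - a) 0 * (a ^ 2 - b ^ 2)| ≤ 0 + 0 * b + 1 / 2 * b ^ 2 + 0 * b ^ 3 + 1 / 2 * b ^ 4 := by
  have hR : 0 + 0 * b + 1 / 2 * b ^ 2 + 0 * b ^ 3 + 1 / 2 * b ^ 4 = (b ^ 2 + b ^ 4) / 2 := by ring
  rw [hR]
  rcases le_or_gt b a with hb | hb
  · rw [max_eq_right (sub_nonpos.2 hb), zero_mul, abs_zero]
    positivity
  · have hb0 : 0 ≤ b := ha.trans hb.le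
    rw [max_eq_left (sub_pos.2 hb).le, abs_mul, abs_of_nonneg (sub_pos.2 hb).le,
      abs_of_nonpos (by nlinarith), neg_sub]
    have h1 : b - a ≤ b := by linarith
    have h2 : b ^ 2 - a ^ 2 ≤ b ^ 2 := by nlinarith
    calc (b - a) * (b ^ 2 - a ^ 2) ≤ b * b ^ 2 :=
          mul_le_mul h1 h2 (by nlinarith) hb0
      _ ≤ (b ^ 2 + b ^ 4) / 2 := by nlinarith [sq_nonneg (b * (b - 1))]

/-! ## The half-Gaussian mean `h(a) = ∫ (a − b)₊ dγ₁` -/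

/-- `(a − b)₊` is `γ₁`-integrable. [folklore] -/
theorem k2r_ref_integrable_posPart_sub (a : ℝ) :
    Integrable (fun b : ℝ => max (a - b) 0) (gaussianReal 0 1) := by
  refine k2r_ref_integrable_of_le_poly (C := 1 + |a|) (n := 1) (by fun_prop) fun b => ?_
  refine (k2r_ref_abs_posPart_le _).trans ((abs_sub a b).trans ?_)
  nlinarith [abs_nonneg a, abs_nonneg b]

/-- `(b − a)₊` is `γ₁`-integrable. [folklore] -/
theorem k2r_ref_integrable_posPart_sub' (a : ℝ) :
    Integrable (fun b : ℝ => max (b - a) 0) (gaussianReal 0 1) := by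
  refine k2r_ref_integrable_of_le_poly (C := 1 + |a|) (n := 1) (by fun_prop) fun b => ?_
  refine (k2r_ref_abs_posPart_le _).trans ((abs_sub b a).trans ?_)
  nlinarith [abs_nonneg a, abs_nonneg b]

/-- `b ↦ a − b` is `γ₁`-integrable with `∫ (a − b) dγ₁(b) = a`. [folklore] -/
theorem k2r_ref_integral_sub (a : ℝ) :
    Integrable (fun b : ℝ => a - b) (gaussianReal 0 1) ∧ ∫ b, (a - b) ∂gaussianReal 0 1 = a := by
  have hid : Integrable (fun b : ℝ => b) (gaussianReal 0 1) := by
    simpa using integrable_pow_gaussianReal 0 1 1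
  refine ⟨(integrable_const a).sub hid, ?_⟩
  rw [integral_sub (integrable_const a) hid, integral_const, k2r_ref_moment_one]
  simp

/-- **`h(a) ≥ a₊`.** [folklore] -/
theorem k2r_ref_h_ge (a : ℝ) : max a 0 ≤ ∫ b, max (a - b) 0 ∂gaussianReal 0 1 := by
  refine max_le ?_ (integral_nonneg fun b => le_max_right _ _)
  calc a = ∫ b, (a - b) ∂gaussianReal 0 1 := (k2r_ref_integral_sub a).2.symm
    _ ≤ ∫ b, max (a - b) 0 ∂gaussianReal 0 1 :=
        integral_mono (k2r_ref_integral_sub a).1 (k2r_ref_integrable_posPart_sub a) fun b => le_max_left _ _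

/-- Reflection symmetry of `γ₁`: `∫ (−a − b)₊ dγ₁(b) = ∫ (b − a)₊ dγ₁(b)`. [folklore] -/
theorem k2r_ref_h_neg_eq (a : ℝ) :
    ∫ b, max (-a - b) 0 ∂gaussianReal 0 1 = ∫ b, max (b - a) 0 ∂gaussianReal 0 1 := by
  have hm : (gaussianReal 0 1).map (fun x => -x) = gaussianReal 0 1 := by
    rw [gaussianReal_map_neg, neg_zero]
  conv_lhs => rw [← hm]
  rw [integral_map measurable_neg.aemeasurable (by fun_prop)]
  refine integral_congr_ae (ae_of_all _ fun b => ?_)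
  show max (-a - -b) 0 = max (b - a) 0
  ring_nf

/-- **`h(a) − h(−a) = a`.** [folklore] -/
theorem k2r_ref_h_sub_h_neg (a : ℝ) :
    (∫ b, max (a - b) 0 ∂gaussianReal 0 1) - ∫ b, max (-a - b) 0 ∂gaussianReal 0 1 = a := by
  rw [k2r_ref_h_neg_eq, ← integral_sub (k2r_ref_integrable_posPart_sub a) (k2r_ref_integrable_posPart_sub' a)]
  have hpt : ∀ b : ℝ, max (a - b) 0 - max (b - a) 0 = a - b := fun b => by
    have h := k2r_ref_posPart_eq (a - b)
    rw [neg_sub] at h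
    linarith
  simp_rw [hpt]
  exact (k2r_ref_integral_sub a).2

/-- `∫ c₊ dγ₁ ≤ 1`. [folklore] -/
theorem k2r_ref_integral_posPart_le_one : ∫ c, max c 0 ∂gaussianReal 0 1 ≤ 1 := by
  have hint : Integrable (fun c : ℝ => max c 0) (gaussianReal 0 1) := by
    simpa using k2r_ref_integrable_posPart_sub' 0
  have hpoly : Integrable (fun x : ℝ => 1 / 2 + 0 * x + 1 / 2 * x ^ 2 + 0 * x ^ 3 + 0 * x ^ 4)
      (gaussianReal 0 1) := by
    refine k2r_ref_integrable_of_le_poly (C := 1) (n := 2) (by fun_prop) fun b => ?_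
    rw [abs_of_nonneg (by nlinarith [sq_nonneg b])]
    nlinarith [abs_nonneg b, sq_abs b]
  calc ∫ c, max c 0 ∂gaussianReal 0 1
      ≤ ∫ x : ℝ, (1 / 2 + 0 * x + 1 / 2 * x ^ 2 + 0 * x ^ 3 + 0 * x ^ 4) ∂gaussianReal 0 1 :=
        integral_mono hint hpoly k2r_ref_posPart_le_quad
    _ = 1 := by rw [k2r_ref_integral_poly]; norm_num

/-- Integrability against the standard normal density transfers to Lebesgue measure. [folklore] -/
theorem k2r_ref_integrable_mul_phi {f : ℝ → ℝ} (hf : Integrable f (gaussianReal 0 1)) :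
    Integrable fun b => f b * (Real.exp (-b ^ 2 / 2) / Real.sqrt (2 * Real.pi)) := by
  rw [gaussianReal_of_var_ne_zero 0 one_ne_zero,
    integrable_withDensity_iff_integrable_smul' (measurable_gaussianPDF 0 1)
      (ae_of_all _ fun _ => gaussianPDF_lt_top)] at hf
  refine hf.congr (ae_of_all _ fun b => ?_)
  show (gaussianPDF 0 1 b).toReal • f b = f b * _
  rw [gaussianPDF, ENNReal.toReal_ofReal (gaussianPDFReal_nonneg _ _ _), smul_eq_mul, k2r_ref_phi_eq,
    mul_comm]

/-- **`h(a) ≤ e^{-a²/2}` for `a ≤ 0`** (pointwise `e^{-b²/2} ≤ e^{-a²/2} e^{-(a-b)²/2}` for `b ≤ a ≤ 0`,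
translation invariance of Lebesgue measure and `∫ c₊ dγ₁ ≤ 1`). [folklore] -/
theorem k2r_ref_h_le_exp {a : ℝ} (ha : a ≤ 0) :
    ∫ b, max (a - b) 0 * (Real.exp (-b ^ 2 / 2) / Real.sqrt (2 * Real.pi)) ≤ Real.exp (-a ^ 2 / 2) := by
  set ψ : ℝ → ℝ := fun b => Real.exp (-b ^ 2 / 2) / Real.sqrt (2 * Real.pi) with hψ
  have hψ0 : ∀ b, 0 ≤ ψ b := fun b => by rw [hψ]; positivity
  have hpt : ∀ b, max (a - b) 0 * ψ b ≤ Real.exp (-a ^ 2 / 2) * (max (a - b) 0 * ψ (a - b)) := by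
    intro b
    rcases le_or_gt b a with hb | hb
    · have hab : 0 ≤ a - b := sub_nonneg.2 hb
      rw [max_eq_left hab]
      have hexp : Real.exp (-b ^ 2 / 2) ≤ Real.exp (-a ^ 2 / 2) * Real.exp (-(a - b) ^ 2 / 2) := by
        rw [← Real.exp_add]
        exact Real.exp_le_exp.2 (by nlinarith [mul_nonneg (neg_nonneg.2 ha) hab])
      calc (a - b) * ψ b = (a - b) / Real.sqrt (2 * Real.pi) * Real.exp (-b ^ 2 / 2) := by
            rw [hψ]; ring
        _ ≤ (a - b) / Real.sqrt (2 * Real.pi) * (Real.exp (-a ^ 2 / 2) * Real.exp (-(a - b) ^ 2 / 2)) :=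
            mul_le_mul_of_nonneg_left hexp (by positivity)
        _ = Real.exp (-a ^ 2 / 2) * ((a - b) * ψ (a - b)) := by rw [hψ]; ring
    · rw [max_eq_right (sub_neg.2 hb).le, zero_mul, zero_mul, mul_zero]
  have hint1 : Integrable fun c => max c 0 * ψ c := by
    have h0 : Integrable (fun c : ℝ => max c 0) (gaussianReal 0 1) := by
      simpa using k2r_ref_integrable_posPart_sub' 0
    exact k2r_ref_integrable_mul_phi h0
  have hint2 : Integrable fun b => Real.exp (-a ^ 2 / 2) * (max (a - b) 0 * ψ (a - b)) :=
    (hint1.comp_sub_left a).const_mul _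
  calc ∫ b, max (a - b) 0 * ψ b
      ≤ ∫ b, Real.exp (-a ^ 2 / 2) * (max (a - b) 0 * ψ (a - b)) :=
        integral_mono_of_nonneg (ae_of_all _ fun b => mul_nonneg (le_max_right _ _) (hψ0 b)) hint2
          (ae_of_all _ hpt)
    _ = Real.exp (-a ^ 2 / 2) * ∫ c, max c 0 * ψ c := by
        rw [integral_const_mul]
        congr 1
        exact integral_sub_left_eq_self (fun c => max c 0 * ψ c) volume a
    _ ≤ Real.exp (-a ^ 2 / 2) * 1 := by
        refine mul_le_mul_of_nonneg_left ?_ (Real.exp_pos _).le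
        rw [hψ, k2r_ref_integral_mul_phi]
        exact k2r_ref_integral_posPart_le_one
    _ = Real.exp (-a ^ 2 / 2) := mul_one _

/-! ## Second and cubic half-moments -/

/-- **`0 ≤ P₂(a) ≤ 1 + a²`.** [folklore] -/
theorem k2r_ref_P2_bounds (a : ℝ) :
    0 ≤ ∫ b, max (a - b) 0 ^ 2 ∂gaussianReal 0 1 ∧ ∫ b, max (a - b) 0 ^ 2 ∂gaussianReal 0 1 ≤ 1 + a ^ 2 := by
  refine ⟨integral_nonneg fun b => sq_nonneg _, ?_⟩
  have hpoly : ∀ b : ℝ, (a - b) ^ 2 = a ^ 2 + (-2 * a) * b + 1 * b ^ 2 + 0 * b ^ 3 + 0 * b ^ 4 := fun b => by ring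
  have hint1 : Integrable (fun b : ℝ => max (a - b) 0 ^ 2) (gaussianReal 0 1) := by
    refine k2r_ref_integrable_of_le_poly (C := (1 + |a|) ^ 2) (n := 2) (by fun_prop) fun b => ?_
    rw [abs_of_nonneg (sq_nonneg _), ← mul_pow]
    refine pow_le_pow_left₀ (le_max_right _ _) (max_le ?_ (by positivity)) 2
    nlinarith [abs_nonneg a, abs_nonneg b, le_abs_self a, neg_abs_le b]
  have hint2 : Integrable (fun b : ℝ => (a - b) ^ 2) (gaussianReal 0 1) := by
    refine k2r_ref_integrable_of_le_poly (C := (1 + |a|) ^ 2) (n := 2) (by fun_prop) fun b => ?_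
    rw [abs_of_nonneg (sq_nonneg _), ← mul_pow, ← sq_abs (a - b)]
    refine pow_le_pow_left₀ (abs_nonneg _) ((abs_sub a b).trans ?_) 2
    nlinarith [abs_nonneg a, abs_nonneg b]
  calc ∫ b, max (a - b) 0 ^ 2 ∂gaussianReal 0 1 ≤ ∫ b, (a - b) ^ 2 ∂gaussianReal 0 1 := by
        refine integral_mono hint1 hint2 fun b => ?_
        have h := k2r_ref_abs_posPart_le (a - b)
        exact sq_le_sq.2 (by simpa using h)
    _ = 1 + a ^ 2 := by simp_rw [hpoly]; rw [k2r_ref_integral_poly]; ring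

/-- `(a − b)₊ (a² − b²)` is `γ₁`-integrable. [folklore] -/
theorem k2r_ref_integrable_cubic (a : ℝ) :
    Integrable (fun b : ℝ => max (a - b) 0 * (a ^ 2 - b ^ 2)) (gaussianReal 0 1) := by
  refine k2r_ref_integrable_of_le_poly (C := (1 + |a|) ^ 3) (n := 3) (by fun_prop) fun b => ?_
  rw [abs_mul]
  have h1 : |max (a - b) 0| ≤ (1 + |a|) * (1 + |b|) :=
    (k2r_ref_abs_posPart_le _).trans ((abs_sub a b).trans (by nlinarith [abs_nonneg a, abs_nonneg b]))
  have h2 : |a ^ 2 - b ^ 2| ≤ ((1 + |a|) * (1 + |b|)) ^ 2 := by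
    refine (abs_sub _ _).trans ?_
    rw [abs_pow, abs_pow]
    nlinarith [abs_nonneg a, abs_nonneg b, mul_nonneg (abs_nonneg a) (abs_nonneg b),
      sq_nonneg (|a| * |b|), sq_nonneg (|a| + |b|)]
  calc |max (a - b) 0| * |a ^ 2 - b ^ 2| ≤ (1 + |a|) * (1 + |b|) * ((1 + |a|) * (1 + |b|)) ^ 2 :=
        mul_le_mul h1 h2 (abs_nonneg _) (by positivity)
    _ = (1 + |a|) ^ 3 * (1 + |b|) ^ 3 := by ring

/-- **`|P₃(a) − a₊³| ≤ 3 (1 + |a|)`** (`P₃(a) = a³ − a + ∫ (b−a)₊(a²−b²) dγ₁` for `a ≥ 0`, and the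
remainder / the whole integral for `a ≤ 0` is at most `∫ (b² + b⁴)/2 dγ₁ = 2`). [folklore] -/
theorem k2r_ref_P3_bound (a : ℝ) :
    |(∫ b, max (a - b) 0 * (a ^ 2 - b ^ 2) ∂gaussianReal 0 1) - max a 0 ^ 3| ≤ 3 * (1 + |a|) := by
  have hq : Integrable (fun b : ℝ => 0 + 0 * b + 1 / 2 * b ^ 2 + 0 * b ^ 3 + 1 / 2 * b ^ 4)
      (gaussianReal 0 1) := by
    refine k2r_ref_integrable_of_le_poly (C := 1) (n := 4) (by fun_prop) fun b => ?_
    rw [abs_of_nonneg (by nlinarith [sq_nonneg b, sq_nonneg (b ^ 2)])]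
    nlinarith [abs_nonneg b, sq_abs b, sq_nonneg b, sq_nonneg (b ^ 2), pow_nonneg (abs_nonneg b) 3]
  have hq2 : ∫ b, (0 + 0 * b + 1 / 2 * b ^ 2 + 0 * b ^ 3 + 1 / 2 * b ^ 4) ∂gaussianReal 0 1 = 2 := by
    rw [k2r_ref_integral_poly]; norm_num
  rcases le_total 0 a with ha | ha
  · -- `a ≥ 0`: split off the polynomial part
    rw [max_eq_left ha, abs_of_nonneg ha]
    have hpt : ∀ b : ℝ, max (a - b) 0 * (a ^ 2 - b ^ 2) =
        max (b - a) 0 * (a ^ 2 - b ^ 2) + (a ^ 3 + (-a ^ 2) * b + (-a) * b ^ 2 + 1 * b ^ 3 + 0 * b ^ 4) := by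
      intro b
      rw [k2r_ref_posPart_eq (a - b), neg_sub]
      ring
    have hR : Integrable (fun b : ℝ => max (b - a) 0 * (a ^ 2 - b ^ 2)) (gaussianReal 0 1) :=
      k2r_ref_integrable_of_le_poly (C := 1) (n := 4) (by fun_prop) fun b =>
        (k2r_ref_cubic_pt ha b).trans (by
          nlinarith [abs_nonneg b, sq_abs b, sq_nonneg b, sq_nonneg (b ^ 2), pow_nonneg (abs_nonneg b) 3,
            pow_nonneg (abs_nonneg b) 1])
    have hP : Integrable (fun b : ℝ => a ^ 3 + (-a ^ 2) * b + (-a) * b ^ 2 + 1 * b ^ 3 + 0 * b ^ 4)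
        (gaussianReal 0 1) := by
      have h := (k2r_ref_integrable_cubic a).sub hR
      refine h.congr (ae_of_all _ fun b => ?_)
      show max (a - b) 0 * (a ^ 2 - b ^ 2) - max (b - a) 0 * (a ^ 2 - b ^ 2) = _
      rw [hpt b]; ring
    simp_rw [hpt]
    rw [integral_add hR hP, k2r_ref_integral_poly]
    have hRb : |∫ b, max (b - a) 0 * (a ^ 2 - b ^ 2) ∂gaussianReal 0 1| ≤ 2 := by
      rw [← hq2, ← Real.norm_eq_abs]
      exact norm_integral_le_of_norm_le hq (ae_of_all _ fun b => (Real.norm_eq_abs _).le.trans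
        (k2r_ref_cubic_pt ha b))
    set R := ∫ b, max (b - a) 0 * (a ^ 2 - b ^ 2) ∂gaussianReal 0 1
    have e : R + (a ^ 3 + -a + 3 * 0) - a ^ 3 = R - a := by ring
    rw [e]
    calc |R - a| ≤ |R| + |a| := abs_sub R a
      _ ≤ 3 * (1 + a) := by rw [abs_of_nonneg ha]; linarith
  · -- `a ≤ 0`: the whole integral is a remainder
    rw [max_eq_right ha, abs_of_nonpos ha]
    have hpt : ∀ b : ℝ, |max (a - b) 0 * (a ^ 2 - b ^ 2)| ≤
        0 + 0 * b + 1 / 2 * b ^ 2 + 0 * b ^ 3 + 1 / 2 * b ^ 4 := by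
      intro b
      have h := k2r_ref_cubic_pt (neg_nonneg.2 ha) (-b)
      have e1 : -b - -a = a - b := by ring
      rw [e1, neg_sq, neg_sq] at h
      refine h.trans (le_of_eq ?_)
      ring
    have hb : |∫ b, max (a - b) 0 * (a ^ 2 - b ^ 2) ∂gaussianReal 0 1| ≤ 2 := by
      rw [← hq2, ← Real.norm_eq_abs]
      exact norm_integral_le_of_norm_le hq (ae_of_all _ fun b => (Real.norm_eq_abs _).le.trans (hpt b))
    rw [zero_pow three_ne_zero, sub_zero]
    linarith [neg_nonneg.2 ha]

/-! ## Registered sub-goal carried by this file -/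

/-- **Registered sub-goal `stub_halfGaussian_prep`** (prep of stub `stub_halfGaussian`, line `refutation` of
K2R): the cubic half-moment bound `|P₃(a) − a₊³| ≤ 3 (1 + |a|)` — verbatim registered signature, proved by
`k2r_ref_P3_bound`. [folklore] -/
theorem stub_halfGaussian_prep : ∀ a : ℝ, |(∫ b, max (a - b) 0 * (a ^ 2 - b ^ 2) ∂ProbabilityTheory.gaussianReal 0 1) - max a 0 ^ 3| ≤ 3 * (1 + |a|) :=
  k2r_ref_P3_bound

end Summit.AtomisticToContinuum.HydrodynamicLimit.Theorems.EnskogAdjointDuality
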